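import Summits.BirchSwinnertonDyer.Rank1Residual.P2.CongruentNumberOddAokiMonskyForms
import HarnessLib

/-!
# Cell `bsd-monsky`: AOKI = MONSKY, THE ODD CLASSES — part 1, the kernel count for Monsky's ODD matrix
# `M = ( A + D₂  D₂ ; D₂  A + D₋₂ )` (pure `𝔽₂`-linear algebra; nothing arithmetic asserted)

HONEST FRAMING (cell `bsd-monsky`, run/shared/lean/pub/bsd-monsky/, README §1). This file asserts NO arithmetic
fact: it is the linear-algebra core of the ODD half (`n ≡ 3, 7 (mod 8)`) of «Aoki 1999 Thm 2.2 = Monsky's matrix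
count» (even half: `AokiMonsky.selmerDimFormula_two_mul_prod`). Dictionary (HOME/proof/PROOF-B-AOKI-MONSKY.md §5):
`L = Aᵀ` = Aoki's `(λ_{p_j}(p_i))`, `Lᵀ = L + εεᵀ + D_ε` (`hLT`), zero column sums (`hcol`), `Σ ε = 1` (`hodd`);
`M = ( Lᵀ + D_t  D_t ; D_t  Lᵀ + D_t + D_ε )` (`D₋₂ = D_t + D_ε`); `C = L|_{ι × T₁}`; `W₀ = {s : (s ᵥ* L)_j = 0,
j ∈ T₁}`; `G_il = Σ_j ε_j L_ij L_lj + δ_il t_i` (`ν = 0`). THE ODD KERNEL COUNT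
(`finrank_ker_odd_add_two_mul_rank_add_rank_gram`): `dim ker M + 2·rank C + rank (w ⬝ G s)_{W₀ × W₀} = |T₁| + |ι|`
— in the variables `(u, s = u + v)` the equations are `Lᵀu = D_t s`, `Lᵀs + D_εs = D_εu`; `(u, v) ↦ s` has kernel
`≅ ker C` and image `{s ∈ W₀ : G s ⊥ W₀}` (part 0's identity + «column space = annihilator of the left kernel»).
NOT in this file (the rest of the odd theorem): Aoki's `T ∋ 2` for `n ≡ 7 (8)` and the `x ≡ 1 / ±1 (mod 8)`
conditions cut `W₀` down by `ker (t ⬝ ·)` (`= 𝟙 ⬝ G ·` on `W₀`, `𝟙 ⬝ G 𝟙 = Σ t = [n ≡ 3 (8)]`) and `ker (ε ⬝ ·)`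
(`ε ⬝ 𝟙 = 1`): rank drops by exactly `1` (`n ≡ 3`) resp. `2·[t ∉ col C]` (`n ≡ 7`) — restriction lemmas to come.

References: [Aoki1999] Thm. 2.2 p. 81, proof p. 98; [HeathBrown1994SelmerCongruentII] Appendix (Monsky), p. 39 L10–L33.
-/

noncomputable section

open scoped Classical

open Matrix

set_option autoImplicit false

namespace Summit.BirchSwinnertonDyer.Rank1Residual.P2.AokiMonsky

section OddKernel

variable {ι : Type*} [Fintype ι] [DecidableEq ι] (L : Matrix ι ι (ZMod 2)) (ε t : ι → ZMod 2)

/-- **The odd kernel count (Aoki = Monsky, odd classes, linear-algebra core).** With `Lᵀ = L + εεᵀ + D_ε`,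
zero column sums `Σ_j L_ji = 0`, `Σ ε = 1`, Monsky's ODD matrix `M = ( Lᵀ + D_t  D_t ; D_t  Lᵀ + D_t + D_ε )`,
`C = L|_{ι × T₁}` (`T₁ = {ε = 0}`), `W₀ = {s : (s ᵥ* L)_j = 0 ∀ j ∈ T₁}` and `G_il = Σ_j ε_j L_ij L_lj + δ_il t_i`:
`dim ker M + 2·rank C + rank (w ⬝ G s)_{w, s ∈ W₀} = |T₁| + |ι|`. [folklore] -/
theorem finrank_ker_odd_add_two_mul_rank_add_rank_gram
    (hLT : ∀ i j, L j i = L i j + ε i * ε j + if i = j then ε i else 0)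
    (hcol : ∀ i, ∑ j, L j i = 0) (hodd : ∑ j, ε j = 1)
    (G : Matrix ι ι (ZMod 2))
    (hG : ∀ i l, G i l = (∑ j, ε j * (L i j * L l j)) + if i = l then t i else 0)
    (Wfin : Finset (ι → ZMod 2)) (hWfin : ∀ u, u ∈ Wfin ↔ ∀ j, ε j = 0 → (u ᵥ* L) j = 0) :
    Module.finrank (ZMod 2)
        ↥(LinearMap.ker (Matrix.fromBlocks (Lᵀ + Matrix.diagonal t) (Matrix.diagonal t)
          (Matrix.diagonal t) (Lᵀ + Matrix.diagonal t + Matrix.diagonal ε)).mulVecLin) +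
      2 * (L.submatrix id (Subtype.val : {j // ε j = 0} → ι)).rank +
      (Matrix.of fun w w' : ↥Wfin => (w : ι → ZMod 2) ⬝ᵥ (G *ᵥ (w' : ι → ZMod 2))).rank =
      Fintype.card {j // ε j = 0} + Fintype.card ι := by
  set C : Matrix ι {j // ε j = 0} (ZMod 2) := L.submatrix id (Subtype.val : {j // ε j = 0} → ι)
    with hC
  set M : Matrix (ι ⊕ ι) (ι ⊕ ι) (ZMod 2) := Matrix.fromBlocks (Lᵀ + Matrix.diagonal t)
    (Matrix.diagonal t) (Matrix.diagonal t) (Lᵀ + Matrix.diagonal t + Matrix.diagonal ε) with hM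
  set Γ : Matrix ↥Wfin ↥Wfin (ZMod 2) :=
    Matrix.of fun w w' : ↥Wfin => (w : ι → ZMod 2) ⬝ᵥ (G *ᵥ (w' : ι → ZMod 2)) with hΓ
  set W : Submodule (ZMod 2) (ι → ZMod 2) := LinearMap.ker Cᵀ.mulVecLin with hWdef
  set K : Submodule (ZMod 2) (ι ⊕ ι → ZMod 2) := LinearMap.ker M.mulVecLin with hKdef
  set B : Matrix ↥Wfin ι (ZMod 2) :=
    Matrix.of fun (w : ↥Wfin) (i : ι) => ((w : ι → ZMod 2) ᵥ* G) i with hBdef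
  set F : (ι ⊕ ι → ZMod 2) →ₗ[ZMod 2] (ι → ZMod 2) :=
    LinearMap.funLeft (ZMod 2) (ZMod 2) (Sum.inl : ι → ι ⊕ ι) +
      LinearMap.funLeft (ZMod 2) (ZMod 2) (Sum.inr : ι → ι ⊕ ι) with hF
  have hFapp : ∀ x : ι ⊕ ι → ZMod 2, F x = x ∘ Sum.inl + x ∘ Sum.inr := fun x => rfl
  have hsq : ∀ x : ZMod 2, x * x = x := by decide
  have h01 : ∀ x : ZMod 2, x = 0 ∨ x = 1 := by decide
  have h2f : ∀ f : ι → ZMod 2, f + f = 0 := fun f => by ext i; exact CharTwo.add_self_eq_zero _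
  have hvC : ∀ u : ι → ZMod 2, u ᵥ* C = 0 ↔ ∀ j, ε j = 0 → (u ᵥ* L) j = 0 := by
    intro u
    constructor
    · intro h j hj
      have := congr_fun h ⟨j, hj⟩
      simpa [hC, Matrix.vecMul, dotProduct] using this
    · intro h
      ext ⟨j, hj⟩
      simpa [hC, Matrix.vecMul, dotProduct] using h j hj
  have hW : ∀ u, u ∈ W ↔ ∀ j, ε j = 0 → (u ᵥ* L) j = 0 := by
    intro u
    rw [hWdef, LinearMap.mem_ker, Matrix.mulVecLin_apply, Matrix.mulVec_transpose]
    exact hvC u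
  have hWfin' : ∀ u, u ∈ Wfin ↔ u ∈ W := fun u => (hWfin u).trans (hW u).symm
  -- the kernel equations in the variables `u = x ∘ inl`, `s = u + v`: `Lᵀ u = D_t s`, `Lᵀ s + D_ε s = D_ε u`
  have hK : ∀ x, x ∈ K ↔
      (∀ j, ((x ∘ Sum.inl) ᵥ* L) j = t j * (x (Sum.inl j) + x (Sum.inr j))) ∧
      (∀ j, ((x ∘ Sum.inl + x ∘ Sum.inr) ᵥ* L) j + ε j * (x (Sum.inl j) + x (Sum.inr j)) =
        ε j * x (Sum.inl j)) := by
    intro x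
    rw [hKdef, LinearMap.mem_ker, Matrix.mulVecLin_apply, hM, Matrix.fromBlocks_mulVec]
    have e1 : ∀ j, ((Lᵀ + Matrix.diagonal t) *ᵥ (x ∘ Sum.inl) + Matrix.diagonal t *ᵥ (x ∘ Sum.inr)) j =
        ((x ∘ Sum.inl) ᵥ* L) j + t j * x (Sum.inl j) + t j * x (Sum.inr j) := by
      intro j
      simp only [Matrix.add_mulVec, Pi.add_apply, Matrix.mulVec_diagonal, Matrix.mulVec_transpose,
        Function.comp_apply]
    have e2 : ∀ j, (Matrix.diagonal t *ᵥ (x ∘ Sum.inl) +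
        (Lᵀ + Matrix.diagonal t + Matrix.diagonal ε) *ᵥ (x ∘ Sum.inr)) j =
        t j * x (Sum.inl j) + (((x ∘ Sum.inr) ᵥ* L) j + t j * x (Sum.inr j) + ε j * x (Sum.inr j)) := by
      intro j
      simp only [Matrix.add_mulVec, Pi.add_apply, Matrix.mulVec_diagonal, Matrix.mulVec_transpose,
        Function.comp_apply]
    have hadd : ∀ j, ((x ∘ Sum.inl + x ∘ Sum.inr) ᵥ* L) j =
        ((x ∘ Sum.inl) ᵥ* L) j + ((x ∘ Sum.inr) ᵥ* L) j := by
      intro j; rw [Matrix.add_vecMul, Pi.add_apply]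
    have key : ∀ a b ti ui vi ei : ZMod 2,
        (a + ti * ui + ti * vi = 0 ∧ ti * ui + (b + ti * vi + ei * vi) = 0) ↔
          (a = ti * (ui + vi) ∧ a + b + ei * (ui + vi) = ei * ui) := by decide
    constructor
    · intro h
      have h1 : ∀ j, ((x ∘ Sum.inl) ᵥ* L) j + t j * x (Sum.inl j) + t j * x (Sum.inr j) = 0 := fun j => by
        rw [← e1]; exact congr_fun h (Sum.inl j)
      have h2 : ∀ j, t j * x (Sum.inl j) +
          (((x ∘ Sum.inr) ᵥ* L) j + t j * x (Sum.inr j) + ε j * x (Sum.inr j)) = 0 := fun j => by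
        rw [← e2]; exact congr_fun h (Sum.inr j)
      refine ⟨fun j => ((key _ _ _ _ _ _).mp ⟨h1 j, h2 j⟩).1, fun j => ?_⟩
      rw [hadd]
      exact ((key _ _ _ _ _ _).mp ⟨h1 j, h2 j⟩).2
    · rintro ⟨h1, h2⟩
      ext (j | j)
      · rw [Sum.elim_inl, e1, Pi.zero_apply]
        exact ((key _ (((x ∘ Sum.inr) ᵥ* L) j) _ _ _ _).mpr ⟨h1 j, by rw [← hadd]; exact h2 j⟩).1
      · rw [Sum.elim_inr, e2, Pi.zero_apply]
        exact ((key _ (((x ∘ Sum.inr) ᵥ* L) j) _ _ _ _).mpr ⟨h1 j, by rw [← hadd]; exact h2 j⟩).2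
  have hBapp : ∀ (w : ↥Wfin) (u : ι → ZMod 2), (B *ᵥ u) w = (w : ι → ZMod 2) ⬝ᵥ (G *ᵥ u) := by
    intro w u
    rw [Matrix.dotProduct_mulVec]
    rfl
  -- Aoki's Gram form on `W₀`: `w ⬝ G s = Σ_i t_i w_i s_i + (w ᵥ* L) ⬝ (s ᵥ* L)`
  have hGram : ∀ w s : ι → ZMod 2, (∀ j, ε j = 0 → (s ᵥ* L) j = 0) →
      w ⬝ᵥ (G *ᵥ s) = (∑ i, t i * (w i * s i)) + (w ᵥ* L) ⬝ᵥ (s ᵥ* L) := by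
    intro w s hs
    have hL : w ⬝ᵥ (G *ᵥ s) = ∑ i, ∑ l, w i * (G i l * s l) := by
      simp only [dotProduct, Matrix.mulVec, Finset.mul_sum]
    have hpt : ∀ i l, w i * (G i l * s l) =
        (w i * s l) * (∑ j, ε j * (L i j * L l j)) + (if i = l then t i * (w i * s l) else 0) := by
      intro i l; rw [hG i l]; split_ifs <;> ring
    have hSA : ∑ i, ∑ l, (w i * s l) * (∑ j, ε j * (L i j * L l j)) = ∑ j, ε j * ((w ᵥ* L) j * (s ᵥ* L) j) := by
      have hA' : ∀ j, (w ᵥ* L) j = ∑ i, w i * L i j := fun j => rfl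
      have hB' : ∀ j, (s ᵥ* L) j = ∑ l, s l * L l j := fun j => rfl
      have eL : ∀ i l, (w i * s l) * (∑ j, ε j * (L i j * L l j)) =
          ∑ j, (w i * s l) * (ε j * (L i j * L l j)) := fun i l => Finset.mul_sum _ _ _
      have eR : ∀ j, ε j * ((w ᵥ* L) j * (s ᵥ* L) j) = ∑ i, ∑ l, ε j * ((w i * L i j) * (s l * L l j)) := by
        intro j
        rw [hA', hB', Finset.sum_mul_sum, Finset.mul_sum]
        exact Finset.sum_congr rfl fun i _ => Finset.mul_sum _ _ _
      rw [Finset.sum_congr rfl fun j _ => eR j]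
      conv_rhs => rw [Finset.sum_comm]
      refine Finset.sum_congr rfl fun i _ => ?_
      rw [Finset.sum_congr rfl fun l _ => eL i l]
      conv_lhs => rw [Finset.sum_comm]
      exact Finset.sum_congr rfl fun j _ => Finset.sum_congr rfl fun l _ => by ring
    have hSB : ∑ i, ∑ l, (if i = l then t i * (w i * s l) else 0) = ∑ i, t i * (w i * s i) :=
      Finset.sum_congr rfl fun i _ => by rw [Finset.sum_ite_eq, if_pos (Finset.mem_univ i)]
    rw [hL, show (w ᵥ* L) ⬝ᵥ (s ᵥ* L) = ∑ j, ε j * ((w ᵥ* L) j * (s ᵥ* L) j) from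
      Finset.sum_congr rfl fun j _ => by
        rw [mul_comm ((w ᵥ* L) j), ← mul_assoc, eps_mul_vecMul_apply_of_memW L ε hs j],
      ← hSA, ← hSB, add_comm, ← Finset.sum_add_distrib]
    refine Finset.sum_congr rfl fun i _ => ?_
    rw [← Finset.sum_add_distrib]
    exact Finset.sum_congr rfl fun l _ => hpt i l
  -- (0) rank–nullity for `F` on `K`
  have hsplit : Module.finrank (ZMod 2) ↥(K.map F) +
      Module.finrank (ZMod 2) ↥(K ⊓ LinearMap.ker F) = Module.finrank (ZMod 2) ↥K := by
    have hrn := LinearMap.finrank_range_add_finrank_ker (F ∘ₗ K.subtype)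
    rw [LinearMap.range_comp, Submodule.range_subtype, LinearMap.ker_comp] at hrn
    have heq : Submodule.comap K.subtype (LinearMap.ker F) =
        Submodule.comap K.subtype (K ⊓ LinearMap.ker F) := by
      rw [Submodule.comap_inf, Submodule.comap_subtype_self, top_inf_eq]
    rw [heq] at hrn
    rw [← (Submodule.comapSubtypeEquivOfLe (inf_le_left : K ⊓ LinearMap.ker F ≤ K)).finrank_eq]
    exact hrn
  have hext : ∀ (y : {j // ε j = 0} → ZMod 2) (i : ι),
      (Lᵀ *ᵥ fun j => if h : ε j = 0 then y ⟨j, h⟩ else 0) i = (C *ᵥ y) i :=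
    fun y i => transpose_mulVec_extend L ε hLT y i
  have hεext : ∀ (y : {j // ε j = 0} → ZMod 2) (j : ι),
      ε j * (fun j => if h : ε j = 0 then y ⟨j, h⟩ else 0) j = 0 := by
    intro y j
    by_cases h : ε j = 0
    · simp [h]
    · simp [h]
  -- (1) `K ∩ ker F ≅ ker C`: `s = 0`, `u = v ⊆ T₁`, `Lᵀ u = 0`
  have hvz : ∀ x : ι ⊕ ι → ZMod 2, x ∈ K ⊓ LinearMap.ker F →
      (∀ i, x (Sum.inr i) = x (Sum.inl i)) ∧ (∀ j, ¬ ε j = 0 → x (Sum.inl j) = 0) ∧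
        (fun j : {j // ε j = 0} => x (Sum.inl (j : ι))) ∈ LinearMap.ker C.mulVecLin := by
    intro x hx
    obtain ⟨hxK, hxF⟩ := Submodule.mem_inf.mp hx
    rw [LinearMap.mem_ker, hFapp] at hxF
    obtain ⟨h1, h2⟩ := (hK x).mp hxK
    have hs : ∀ i, x (Sum.inl i) + x (Sum.inr i) = 0 := fun i => congr_fun hxF i
    have hvu : ∀ i, x (Sum.inr i) = x (Sum.inl i) := fun i =>
      (CharTwo.add_eq_zero.mp (hs i)).symm
    have hu0 : ∀ j, ¬ ε j = 0 → x (Sum.inl j) = 0 := by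
      intro j hj
      have := h2 j
      rw [hxF, Matrix.zero_vecMul, Pi.zero_apply, zero_add, hs j, mul_zero] at this
      rcases h01 (ε j) with h0 | h0
      · exact absurd h0 hj
      · rw [h0, one_mul] at this; exact this.symm
    refine ⟨hvu, hu0, ?_⟩
    rw [LinearMap.mem_ker, Matrix.mulVecLin_apply]
    have hxext : (fun j => if h : ε j = 0 then
        (fun j' : {j // ε j = 0} => x (Sum.inl (j' : ι))) ⟨j, h⟩ else 0) = x ∘ Sum.inl := by
      ext j
      by_cases h : ε j = 0
      · simp [h]
      · simp [h, hu0 j h]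
    ext i
    rw [← hext, hxext, Pi.zero_apply, Matrix.mulVec_transpose, h1 i, hs i, mul_zero]
  let e : ↥(K ⊓ LinearMap.ker F) ≃ₗ[ZMod 2] ↥(LinearMap.ker C.mulVecLin) :=
    { toFun := fun x => ⟨fun j => (x : ι ⊕ ι → ZMod 2) (Sum.inl (j : ι)), (hvz x x.2).2.2⟩
      map_add' := fun x x' => rfl
      map_smul' := fun c x => rfl
      invFun := fun y => ⟨Sum.elim (fun i => if h : ε i = 0 then (y : {j // ε j = 0} → ZMod 2) ⟨i, h⟩ else 0)
          (fun i => if h : ε i = 0 then (y : {j // ε j = 0} → ZMod 2) ⟨i, h⟩ else 0), by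
        have hy0 : Lᵀ *ᵥ (fun i => if h : ε i = 0 then (y : {j // ε j = 0} → ZMod 2) ⟨i, h⟩ else 0) = 0 := by
          ext i
          rw [hext]
          have := y.2
          rw [LinearMap.mem_ker, Matrix.mulVecLin_apply] at this
          exact congr_fun this i
        rw [Submodule.mem_inf]
        constructor
        · rw [hK]
          constructor
          · intro j
            rw [Sum.elim_comp_inl, Sum.elim_inl, Sum.elim_inr, ← Matrix.mulVec_transpose, hy0,
              Pi.zero_apply, CharTwo.add_self_eq_zero, mul_zero]
          · intro j
            rw [Sum.elim_comp_inl, Sum.elim_comp_inr, Sum.elim_inl, Sum.elim_inr, h2f,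
              Matrix.zero_vecMul, Pi.zero_apply, CharTwo.add_self_eq_zero, mul_zero, zero_add, hεext]
        · rw [LinearMap.mem_ker, hFapp, Sum.elim_comp_inl, Sum.elim_comp_inr]
          exact h2f _⟩
      left_inv := fun x => by
        obtain ⟨hvu, hu0, -⟩ := hvz x x.2
        apply Subtype.ext
        ext (i | i)
        · simp only [Sum.elim_inl]
          by_cases h : ε i = 0
          · simp [h]
          · simp [h, hu0 i h]
        · simp only [Sum.elim_inr]
          rw [hvu i]
          by_cases h : ε i = 0
          · simp [h]
          · simp [h, hu0 i h]
      right_inv := fun y => by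
        apply Subtype.ext
        ext j
        simp [j.2] }
  have hb : Module.finrank (ZMod 2) ↥(K ⊓ LinearMap.ker F) =
      Module.finrank (ZMod 2) ↥(LinearMap.ker C.mulVecLin) := e.finrank_eq
  have hb2 : Module.finrank (ZMod 2) ↥(LinearMap.ker C.mulVecLin) + C.rank =
      Fintype.card {j // ε j = 0} := by
    have h := LinearMap.finrank_range_add_finrank_ker C.mulVecLin
    rw [Module.finrank_pi (ZMod 2)] at h
    rw [Matrix.rank]
    omega
  -- (2) `F(K) = {s ∈ W₀ : w ⬝ G s = 0 ∀ w ∈ W₀}`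
  have h20 : (2 : ZMod 2) = 0 := by decide
  have htr : ∀ (w : ι → ZMod 2) (j : ι),
      (L *ᵥ w) j = (w ᵥ* L) j + ε j * (∑ i, ε i * w i) + ε j * w j := by
    intro w j
    have := vecMul_apply_eq L ε hLT w j
    have key : ∀ a b c d : ZMod 2, a = b + c + d → b = a + c + d := by decide
    exact key _ _ _ _ this
  have hkey : ∀ a b : ZMod 2, a + (b + a) = b := by decide
  have ha : K.map F = W ⊓ LinearMap.ker B.mulVecLin := by
    apply le_antisymm
    · rintro _ ⟨x, hxK, rfl⟩
      rw [hFapp]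
      obtain ⟨h1, h2⟩ := (hK x).mp hxK
      obtain ⟨u, hu⟩ : ∃ u : ι → ZMod 2, u = x ∘ Sum.inl := ⟨_, rfl⟩
      obtain ⟨s, hs⟩ : ∃ s : ι → ZMod 2, s = x ∘ Sum.inl + x ∘ Sum.inr := ⟨_, rfl⟩
      have huj : ∀ j, x (Sum.inl j) = u j := fun j => by rw [hu]; rfl
      have hsj : ∀ j, x (Sum.inl j) + x (Sum.inr j) = s j := fun j => by rw [hs]; rfl
      rw [← hs]
      rw [← hu] at h1
      simp only [hsj] at h1 h2
      rw [← hs] at h2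
      simp only [huj] at h2
      have hsW : ∀ j, ε j = 0 → (s ᵥ* L) j = 0 := by
        intro j hj
        have := h2 j
        rw [hj, zero_mul, zero_mul, add_zero] at this
        exact this
      refine Submodule.mem_inf.mpr ⟨(hW _).mpr hsW, ?_⟩
      rw [LinearMap.mem_ker, Matrix.mulVecLin_apply]
      ext w
      have hw : ∀ j, ε j = 0 → ((w : ι → ZMod 2) ᵥ* L) j = 0 := (hWfin _).mp w.2
      rw [hBapp, Pi.zero_apply, hGram _ _ hsW]
      obtain ⟨ω, hω⟩ : ∃ ω : ι → ZMod 2, ω = (w : ι → ZMod 2) := ⟨_, rfl⟩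
      rw [← hω] at hw ⊢
      have hea : ∀ j, ε j * (ω ᵥ* L) j = (ω ᵥ* L) j := eps_mul_vecMul_apply_of_memW L ε hw
      have hbj : ∀ j, (s ᵥ* L) j = ε j * u j + ε j * s j := fun j => by
        have key : ∀ a b c : ZMod 2, a + b = c → a = c + b := by decide
        exact key _ _ _ (h2 j)
      have hA : ∑ i, t i * (ω i * s i) = ω ⬝ᵥ (u ᵥ* L) := by
        simp only [dotProduct]
        exact Finset.sum_congr rfl fun i _ => by rw [h1 i]; ring
      have hB : (ω ᵥ* L) ⬝ᵥ (s ᵥ* L) = u ⬝ᵥ (ω ᵥ* L) + s ⬝ᵥ (ω ᵥ* L) := by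
        simp only [dotProduct, ← Finset.sum_add_distrib]
        refine Finset.sum_congr rfl fun j _ => ?_
        rw [hbj j]
        have e1 := hea j
        linear_combination (u j + s j) * e1
      have hXu := dotProduct_vecMul_add_dotProduct_vecMul L ε hLT ω u
      have hXs := dotProduct_vecMul_add_dotProduct_vecMul L ε hLT ω s
      have hD : ω ⬝ᵥ (s ᵥ* L) = (∑ i, ε i * (ω i * u i)) + ∑ i, ε i * (ω i * s i) := by
        simp only [dotProduct, ← Finset.sum_add_distrib]
        exact Finset.sum_congr rfl fun j _ => by rw [hbj j]; ring
      have hE : (∑ i, ε i * u i) = ∑ i, ε i * s i := by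
        have h0 := sum_vecMul_apply_eq_zero L ε hLT hcol hodd s
        rw [Finset.sum_congr rfl fun j _ => hbj j, Finset.sum_add_distrib] at h0
        exact CharTwo.add_eq_zero.mp h0
      rw [hA, hB]
      linear_combination hXu + hXs - hD + (∑ i, ε i * ω i) * hE +
        ((∑ i, ε i * ω i) * (∑ i, ε i * s i)) * h20
    · intro s hs'
      obtain ⟨hsW', hsB⟩ := Submodule.mem_inf.mp hs'
      have hsW : ∀ j, ε j = 0 → (s ᵥ* L) j = 0 := (hW s).mp hsW'
      rw [LinearMap.mem_ker, Matrix.mulVecLin_apply] at hsB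
      have heb : ∀ j, ε j * (s ᵥ* L) j = (s ᵥ* L) j := eps_mul_vecMul_apply_of_memW L ε hsW
      have hsum0 := sum_vecMul_apply_eq_zero L ε hLT hcol hodd s
      -- the right-hand side `r = D_t s + Lᵀ u₂`, `u₂ = D_ε (s ᵥ* L + s)`, is orthogonal to `W₀`
      obtain ⟨y, hy⟩ := exists_mulVec_eq_of_forall_vecMul_eq_zero C
        (fun i => t i * s i + (Lᵀ *ᵥ fun j => ε j * ((s ᵥ* L) j + s j)) i) (by
          intro w hw0
          have hw : ∀ j, ε j = 0 → (w ᵥ* L) j = 0 := (hvC w).mp hw0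
          have hea : ∀ j, ε j * (w ᵥ* L) j = (w ᵥ* L) j := eps_mul_vecMul_apply_of_memW L ε hw
          have hG0 : w ⬝ᵥ (G *ᵥ s) = 0 := by
            rw [← hBapp ⟨w, (hWfin w).mpr hw⟩ s, hsB, Pi.zero_apply]
          rw [hGram _ _ hsW] at hG0
          have hXs := dotProduct_vecMul_add_dotProduct_vecMul L ε hLT w s
          have h1 : w ⬝ᵥ (fun i => t i * s i + (Lᵀ *ᵥ fun j => ε j * ((s ᵥ* L) j + s j)) i) =
              (∑ i, t i * (w i * s i)) + (L *ᵥ w) ⬝ᵥ (fun j => ε j * ((s ᵥ* L) j + s j)) := by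
            rw [← Matrix.vecMul_transpose L w, ← Matrix.dotProduct_mulVec w Lᵀ]
            simp only [dotProduct, ← Finset.sum_add_distrib]
            exact Finset.sum_congr rfl fun i _ => by ring
          have h2 : (L *ᵥ w) ⬝ᵥ (fun j => ε j * ((s ᵥ* L) j + s j)) =
              (w ᵥ* L) ⬝ᵥ (s ᵥ* L) + s ⬝ᵥ (w ᵥ* L) + (∑ i, ε i * w i) * (∑ j, (s ᵥ* L) j) +
                (∑ i, ε i * w i) * (∑ i, ε i * s i) + w ⬝ᵥ (s ᵥ* L) + ∑ i, ε i * (w i * s i) := by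
            simp only [dotProduct, Finset.mul_sum, ← Finset.sum_add_distrib]
            refine Finset.sum_congr rfl fun j _ => ?_
            rw [htr w j]
            have e1 := hea j
            have e2 := heb j
            have e3 := hsq (ε j)
            linear_combination ((s ᵥ* L) j + s j) * e1 +
              (((∑ i, ε i * w i) + w j) * (ε j + 1)) * e2 +
              ((∑ i, ε i * w i) * s j + w j * s j) * e3
          rw [h1, h2, hsum0]
          linear_combination hG0 + hXs +
            ((∑ i, ε i * w i) * (∑ i, ε i * s i) + ∑ i, ε i * (w i * s i)) * h20)
      -- the solution `u = ext y + u₂`, `v = s + u`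
      obtain ⟨U, hU⟩ : ∃ U : ι → ZMod 2,
          U = (fun j => if h : ε j = 0 then y ⟨j, h⟩ else 0) + fun j => ε j * ((s ᵥ* L) j + s j) := ⟨_, rfl⟩
      have hUL : U ᵥ* L = fun j => t j * s j := by
        rw [← Matrix.mulVec_transpose, hU, Matrix.mulVec_add]
        ext j
        rw [Pi.add_apply, hext, hy, add_assoc, CharTwo.add_self_eq_zero, add_zero]
      have hεU : ∀ j, ε j * U j = (s ᵥ* L) j + ε j * s j := by
        intro j
        rw [hU, Pi.add_apply, mul_add, hεext, zero_add, ← mul_assoc, hsq, mul_add, heb]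
      refine ⟨Sum.elim U (s + U), ?_, ?_⟩
      · rw [SetLike.mem_coe, hK]
        have hsum : ∀ j, Sum.elim U (s + U) (Sum.inl j) + Sum.elim U (s + U) (Sum.inr j) = s j := fun j => by
          rw [Sum.elim_inl, Sum.elim_inr, Pi.add_apply]
          exact hkey _ _
        have hsum' : (Sum.elim U (s + U) ∘ Sum.inl + Sum.elim U (s + U) ∘ Sum.inr) = s := by
          ext j
          rw [Pi.add_apply, Function.comp_apply, Function.comp_apply]
          exact hsum j
        constructor
        · intro j
          rw [hsum, Sum.elim_comp_inl, hUL]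
        · intro j
          rw [hsum', hsum, Sum.elim_inl, hεU]
      · rw [hFapp]
        ext j
        rw [Pi.add_apply, Function.comp_apply, Function.comp_apply, Sum.elim_inl, Sum.elim_inr,
          Pi.add_apply]
        exact hkey _ _
  -- (3) the three dimension counts
  have h2 : Module.finrank (ZMod 2) ↥W + C.rank = Fintype.card ι :=
    finrank_ker_transpose_add_rank C
  have h3 : Γ.rank + Module.finrank (ZMod 2) ↥(W ⊓ LinearMap.ker B.mulVecLin) =
      Module.finrank (ZMod 2) ↥W :=
    rank_gram_add_finrank G Wfin W hWfin'
  rw [ha] at hsplit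
  omega

end OddKernel

end Summit.BirchSwinnertonDyer.Rank1Residual.P2.AokiMonsky

end
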